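import Literature.MathematicalPhysics.QuantumFieldTheory.CentreDominatedWilsonLoops
import Literature.MathematicalPhysics.QuantumFieldTheory.U1GinibreComparison
import Literature.MathematicalPhysics.QuantumLattice.GaugeGroupsUnitaryProofs
import Literature.Probability.LatticeModels.PhasesLowerCorrelations
import HarnessLib

/-!
# `U(1)`-centre domination of Wilson loops (Fröhlich 1979): `|⟨W_ρ(C)⟩_{G,β}| ≤ ⟨cos θ_C⟩_{U(1), Nβ}`

Companion of `CentreDominatedWilsonLoops.lean` (the `ℤ₂`-centre case, PROVED there) resolving its
`TODO(general form)`: the comparison of a lattice gauge theory whose gauge group contains a CENTRAL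
CIRCLE acting by scalars in the representation `ρ` (e.g. `G = U(N)`, `ρ` fundamental) with the
`U(1)` lattice gauge theory at coupling `Nβ`.

J. Fröhlich, *Confinement in `ℤ_n` lattice gauge theories implies confinement in `SU(n)` lattice
Higgs theories*, Phys. Lett. **83B** (1979) 195–198 [Frohlich1979ZN] (primary; not held, acq-10704),
as printed in H. Grosse, *Models in Statistical Physics and Quantum Field Theory* (Springer 1988)
§4.2.4, eqs. (4.129)–(4.134) [Grosse1988]: for a compact gauge group with centre `Z ⊇ Γ`,
`Γ ∈ {ℤ_n, U(1)}`, and a character `χ` on which `Γ` acts by a phase, the Haar substitution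
`g_b ↦ γ_b g_b` (`γ_b ∈ Γ`) writes `⟨χ(g_C)⟩_G` as a `G`-average of expectations of an ABELIAN `Γ`
lattice gauge theory with the fluctuating complex couplings `β χ(g̃_∂P)` ((4.131)–(4.133)); «replacing
all expressions `χ(g̃_∂P)` by [their modulus bound] and then deducing monotonicity in the coupling
constants from the correlation inequality» gives `|⟨χ(g_C)⟩_{G,β}| ≤ d_χ ⟨χ_Γ(γ_C)⟩_{Γ, d_χ β}`
((4.134)). For `Γ = U(1)` the correlation inequality needed is the Messager–Miracle-Solé–Pfister
inequality with complex (phase-shifted) couplings, PROVED in the tree in Ginibre's general framework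
(`Literature.Probability.LatticeModels.abs_phasedGinibreExpect_re_mul_le_of_le`,
`PhasesLowerCorrelations.lean`), which is how S. Chatterjee, arXiv:2602.00436 §3, summarises the
mechanism: «Using an inequality of [Messager–Miracle-Solé–Pfister], [Fröhlich 1979] proved that `U(n)`
lattice gauge theory confines whenever the corresponding `U(1)` theory does.»

## Main results (everything PROVED; no named fact)

* `circleTwist`, `measurePreserving_circleTwist`, `integral_eq_integral_integral_circleTwist`: the
  substitution `U_e ↦ ι(ζ_e) U_e`, `ζ ∈ U(1)^E`, and the averaged Haar invariance
  `∫ g dU = ∫ dU ∫ dζ g(ι(ζ)U)` (Grosse (4.131)).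
* `wilsonAction_circleTwist`, `exp_neg_mul_wilsonAction_circleTwist`, `wilsonLoop_circleTwist`: in the
  background `U` the `ζ`-system is the `U(1)` lattice gauge theory with couplings
  `J_p(U) = β |tr ρ(U_p)| ≤ Nβ` and phases `arg tr ρ(U_p)` (Grosse (4.132)–(4.133)), in the tree's
  `phasedGinibreWeight` form, and the loop is `(1/N) Re(tr ρ(U_C) · ζ_C)`.
* `wilsonExpectation_u1_eq_ginibreExpect_gen`: the torus `U(1)` Wilson loop at coupling `β'` is the
  Ginibre expectation with constant couplings (any dimension / base point; the tree's
  `wilsonExpectation_u1_eq_ginibreExpect` is the `d = 4` case).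
* **`abs_wilsonExpectation_wilsonLoop_le_centralCircle`** (Fröhlich 1979 / Grosse (4.134), `Γ = U(1)`):
  for every compact second-countable `G`, continuous unitary `ρ` on `ℂ^N`, continuous central
  `ι : U(1) → G` with `ρ(ι(z)) = z·1`, `β ≥ 0`, torus `(ℤ/L)^d`:
  `|⟨W_{R×T}⟩_{G,ρ,β,L}| ≤ ⟨W_{R×T}⟩_{U(1), Nβ, L}`.
* `hasAreaLaw_of_centralCircle`: `HasAreaLaw d u1Rep (Nβ) → HasAreaLaw d ρ β` (confinement of the
  centre `U(1)` theory at `Nβ` implies confinement of the `G` theory at `β` — Fröhlich's title claim).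
* `unitaryGroup_abs_wilsonExpectation_wilsonLoop_le_u1`, `unitaryGroup_hasAreaLaw_of_u1`: the case
  `G = U(N)`, `ρ` = fundamental (`unitaryFundamentalRep`), `ι = scalarUnitaryHom`.

HONEST LABEL: a comparison theorem, valid at every `β ≥ 0` in every dimension; it transfers
confinement FROM the abelian theory and says nothing about the mass gap. In `d = 4` the `U(1)`
theory deconfines at weak coupling (tree barrier `AbelianDeconfinementD4`), so the transferred
statement has content only where `U(1)` confines (all `β` in `d = 3` — Göpfert–Mack for the Villain
action; strong coupling in `d = 4`).

## References

* J. Fröhlich, Phys. Lett. 83B (1979) 195–198. [Frohlich1979ZN]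
* H. Grosse, *Models in Statistical Physics and Quantum Field Theory*, Springer 1988, §4.2.4
  (4.129)–(4.134). [Grosse1988]
* A. Messager, S. Miracle-Solé, C. Pfister, Comm. Math. Phys. 58 (1978) 19, Prop. 1.
  [MessagerMiracleSolePfister1978]
* S. Chatterjee, arXiv:2602.00436 (2026), §3 (the summary quoted above). [Chatterjee2026CentralU1]
-/

noncomputable section

open MeasureTheory Filter Finset
open Literature.Probability.LatticeModels Literature.MathematicalPhysics.QuantumLattice

namespace Literature.MathematicalPhysics.QuantumFieldTheory

/-! ### The circle twist `U_e ↦ ι(ζ_e) U_e` and the holonomies -/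

section Algebra

variable {d L N : ℕ} {G : Type*} [Group G] (ρ : G →* Matrix (Fin N) (Fin N) ℂ) (ι : Circle →* G)

/-- The circle twist of a configuration by a `U(1)` link field `ζ` through a homomorphism
`ι : U(1) → G` (into the centre in the applications): `(ι(ζ) · U)_e = ι(ζ_e) U_e` — the substitution
`g_b ↦ γ_b g_b` of Grosse 1988 (4.131). [cite: Grosse1988, §4.2.4 eq. (4.131)] -/
def circleTwist (ζ : GaugeConfig d L Circle) (U : GaugeConfig d L G) : GaugeConfig d L G :=
  fun e => ι (ζ e) * U e

/-- `circleTwist ι ζ U = (ι ∘ ζ) · U` (pointwise product). [cite: Grosse1988, §4.2.4 eq. (4.131)] -/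
theorem circleTwist_eq_mul (ζ : GaugeConfig d L Circle) (U : GaugeConfig d L G) :
    circleTwist ι ζ U = (fun e => ι (ζ e)) * U := rfl

/-- Twisting by `ζ⁻¹` undoes the twist by `ζ`. [cite: Grosse1988, §4.2.4 eq. (4.131)] -/
theorem circleTwist_inv_circleTwist (ζ : GaugeConfig d L Circle) (U : GaugeConfig d L G) :
    circleTwist ι ζ⁻¹ (circleTwist ι ζ U) = U := by
  funext e; simp [circleTwist, map_inv, inv_mul_cancel_left]

/-- Twisting by `ζ` undoes the twist by `ζ⁻¹`. [cite: Grosse1988, §4.2.4 eq. (4.131)] -/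
theorem circleTwist_circleTwist_inv (ζ : GaugeConfig d L Circle) (U : GaugeConfig d L G) :
    circleTwist ι ζ (circleTwist ι ζ⁻¹ U) = U := by
  funext e; simp [circleTwist, map_inv, mul_inv_cancel_left]

/-- A homomorphism applied linkwise passes through plaquette holonomies. [folklore] -/
private theorem plaquetteHolonomy_comp_hom' {H : Type*} [Group H] (φ : H →* G) (σ : GaugeConfig d L H)
    (x : Site d L) (i j : Fin d) :
    plaquetteHolonomy (fun e => φ (σ e)) x i j = φ (plaquetteHolonomy σ x i j) := by
  simp [plaquetteHolonomy, map_mul, map_inv]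

/-- A homomorphism applied linkwise passes through straight-path holonomies. [folklore] -/
private theorem lineHolonomy_comp_hom' {H : Type*} [Group H] (φ : H →* G) (σ : GaugeConfig d L H)
    (k : Fin d) : ∀ (n : ℕ) (y : Site d L),
    lineHolonomy (fun e => φ (σ e)) k n y = φ (lineHolonomy σ k n y)
  | 0, _ => by simp [lineHolonomy]
  | n + 1, y => by rw [lineHolonomy, lineHolonomy, map_mul, lineHolonomy_comp_hom' φ σ k n]

/-- A homomorphism applied linkwise passes through rectangular holonomies. [folklore] -/
private theorem rectangleHolonomy_comp_hom' {H : Type*} [Group H] (φ : H →* G) (σ : GaugeConfig d L H)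
    (x : Site d L) (i j : Fin d) (R T : ℕ) :
    rectangleHolonomy (fun e => φ (σ e)) x i j R T = φ (rectangleHolonomy σ x i j R T) := by
  simp only [rectangleHolonomy, lineHolonomy_comp_hom', map_mul, map_inv]

/-- **Plaquettes under a central circle twist**: `(ι(ζ)U)_p = ι(ζ_p) · U_p`, `ζ_p` the `U(1)`
plaquette holonomy (Grosse (4.132): `γ̃_∂P = ∏_{b ∈ ∂P} γ_b`). [cite: Grosse1988, §4.2.4 eq. (4.132)] -/
theorem plaquetteHolonomy_circleTwist (hι : ∀ z, ι z ∈ Subgroup.center G) (ζ : GaugeConfig d L Circle)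
    (U : GaugeConfig d L G) (x : Site d L) (i j : Fin d) :
    plaquetteHolonomy (circleTwist ι ζ U) x i j = ι (plaquetteHolonomy ζ x i j) * plaquetteHolonomy U x i j := by
  rw [circleTwist_eq_mul, plaquetteHolonomy_mul_of_mem_center _ _ (fun e => hι (ζ e)),
    plaquetteHolonomy_comp_hom']

/-- **Rectangular loops under a central circle twist**: `hol_C(ι(ζ)U) = ι(hol_C ζ) · hol_C U`.
[cite: Grosse1988, §4.2.4 eq. (4.131)] -/
theorem rectangleHolonomy_circleTwist (hι : ∀ z, ι z ∈ Subgroup.center G) (ζ : GaugeConfig d L Circle)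
    (U : GaugeConfig d L G) (x : Site d L) (i j : Fin d) (R T : ℕ) :
    rectangleHolonomy (circleTwist ι ζ U) x i j R T =
      ι (rectangleHolonomy ζ x i j R T) * rectangleHolonomy U x i j R T := by
  rw [circleTwist_eq_mul, rectangleHolonomy_mul_of_mem_center _ _ (fun e => hι (ζ e)),
    rectangleHolonomy_comp_hom']

/-- `Re tr ((z·1) M) = Re(tr M · z)`. [folklore] -/
private theorem trace_re_smul_one_mul (z : ℂ) (M : Matrix (Fin N) (Fin N) ℂ) :
    (((z • (1 : Matrix (Fin N) (Fin N) ℂ)) * M).trace).re = (M.trace * z).re := by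
  rw [Matrix.smul_mul, one_mul, Matrix.trace_smul, smul_eq_mul, mul_comm]

/-- The interaction characters of the torus `U(1)` theory in any dimension: one plaquette holonomy
per plaquette (the tree's `u1TorusChars` is the `d = 4` case). [folklore] -/
def u1PlaquetteChars (d L : ℕ) (p : Plaquette d L) : GaugeConfig d L Circle →ₜ* Circle :=
  u1PlaqChar p.1 p.2.1.1 p.2.1.2

/-- The fluctuating couplings `J_p(U) = β |tr ρ(U_p)|` of the `U(1)` system in the background `U`
(Grosse (4.133): the moduli of the complex couplings `β χ(g̃_∂P)`). [cite: Grosse1988, §4.2.4 eq. (4.133)] -/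
def bgCoupling (β : ℝ) (U : GaugeConfig d L G) (p : Plaquette d L) : ℝ :=
  β * ‖(ρ (plaquetteHolonomy U p.1 p.2.1.1 p.2.1.2)).trace‖

/-- The phases `arg tr ρ(U_p)` of the complex couplings `β χ(g̃_∂P)` (Grosse (4.133)). [cite: Grosse1988, §4.2.4 eq. (4.133)] -/
def bgPhase (U : GaugeConfig d L G) (p : Plaquette d L) : Circle :=
  Circle.exp (Complex.arg (ρ (plaquetteHolonomy U p.1 p.2.1.1 p.2.1.2)).trace)

/-- Polar form of the complex coupling: `J_p(U) Re(u_p(U) ζ_p) = β Re(tr ρ(U_p) · ζ_p)`. [cite: Grosse1988, §4.2.4 eq. (4.133)] -/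
theorem bgCoupling_mul_rePhased (β : ℝ) (U : GaugeConfig d L G) (p : Plaquette d L)
    (ζ : GaugeConfig d L Circle) :
    bgCoupling ρ β U p * rePhased (bgPhase ρ U p) (u1PlaquetteChars d L p) ζ =
      β * ((ρ (plaquetteHolonomy U p.1 p.2.1.1 p.2.1.2)).trace *
        ((u1PlaquetteChars d L p ζ : Circle) : ℂ)).re := by
  set t : ℂ := (ρ (plaquetteHolonomy U p.1 p.2.1.1 p.2.1.2)).trace
  have ht : (‖t‖ : ℂ) * ((bgPhase ρ U p : Circle) : ℂ) = t := by
    rw [bgPhase, Circle.coe_exp]; exact_mod_cast Complex.norm_mul_exp_arg_mul_I t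
  rw [bgCoupling, rePhased, mul_assoc, ← Complex.re_ofReal_mul, ← mul_assoc, ht]

variable {ρ ι}

/-- **The Wilson action under a central circle twist** is the `U(1)` plaquette energy with the
complex couplings `β tr ρ(U_p)`: `S(ι(ζ)U) = ∑_p (N − Re(tr ρ(U_p) · ζ_p))` (Grosse (4.132)–(4.133)).
[cite: Grosse1988, §4.2.4 eq. (4.132)] -/
theorem wilsonAction_circleTwist [NeZero L] (hι : ∀ z, ι z ∈ Subgroup.center G)
    (hρι : ∀ z, ρ (ι z) = (z : ℂ) • (1 : Matrix (Fin N) (Fin N) ℂ)) (ζ : GaugeConfig d L Circle)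
    (U : GaugeConfig d L G) :
    wilsonAction ρ (circleTwist ι ζ U) =
      ∑ p : Plaquette d L, ((N : ℝ) - ((ρ (plaquetteHolonomy U p.1 p.2.1.1 p.2.1.2)).trace *
        ((u1PlaquetteChars d L p ζ : Circle) : ℂ)).re) := by
  unfold wilsonAction
  refine Finset.sum_congr rfl fun p _ => ?_
  rw [plaquetteHolonomy_circleTwist ι hι, map_mul, hρι, trace_re_smul_one_mul]
  rfl

/-- **The twisted Wilson weight is a phased `U(1)` lattice gauge weight** with the couplings
`J_p(U) = β|tr ρ(U_p)|` and phases `arg tr ρ(U_p)`: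
`e^{-β S(ι(ζ)U)} = e^{-βN|P|} · exp(∑_p J_p(U) Re(u_p(U) ζ_p))`, in the tree's `phasedGinibreWeight`
form (Grosse (4.132)–(4.133)). [cite: Grosse1988, §4.2.4 eq. (4.133)] -/
theorem exp_neg_mul_wilsonAction_circleTwist [NeZero L] (hι : ∀ z, ι z ∈ Subgroup.center G)
    (hρι : ∀ z, ρ (ι z) = (z : ℂ) • (1 : Matrix (Fin N) (Fin N) ℂ)) (β : ℝ)
    (ζ : GaugeConfig d L Circle) (U : GaugeConfig d L G) :
    Real.exp (-β * wilsonAction ρ (circleTwist ι ζ U)) =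
      Real.exp (-β * ((N : ℝ) * Fintype.card (Plaquette d L))) *
        phasedGinibreWeight (u1PlaquetteChars d L) (bgCoupling ρ β U) (bgPhase ρ U) ζ := by
  rw [phasedGinibreWeight, ← Real.exp_add]
  congr 1
  have hS : phasedHamiltonian (u1PlaquetteChars d L) (bgCoupling ρ β U) (bgPhase ρ U) ζ =
      β * ∑ p : Plaquette d L, ((ρ (plaquetteHolonomy U p.1 p.2.1.1 p.2.1.2)).trace *
        ((u1PlaquetteChars d L p ζ : Circle) : ℂ)).re := by
    rw [phasedHamiltonian, Finset.mul_sum]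
    exact Finset.sum_congr rfl fun p _ => bgCoupling_mul_rePhased ρ β U p ζ
  rw [wilsonAction_circleTwist hι hρι, hS, Finset.sum_sub_distrib, Finset.sum_const, Finset.card_univ,
    nsmul_eq_mul]
  ring

/-- **The Wilson loop under a central circle twist**: `W_C(ι(ζ)U) = (1/N) Re(tr ρ(U_C) · ζ_C)`.
[cite: Grosse1988, §4.2.4 eq. (4.131)] -/
theorem wilsonLoop_circleTwist (hι : ∀ z, ι z ∈ Subgroup.center G)
    (hρι : ∀ z, ρ (ι z) = (z : ℂ) • (1 : Matrix (Fin N) (Fin N) ℂ)) (ζ : GaugeConfig d L Circle)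
    (x : Site d L) (i j : Fin d) (R T : ℕ) (U : GaugeConfig d L G) :
    wilsonLoop ρ x i j R T (circleTwist ι ζ U) =
      (N : ℝ)⁻¹ * ((ρ (rectangleHolonomy U x i j R T)).trace *
        ((u1RectChar x i j R T ζ : Circle) : ℂ)).re := by
  rw [wilsonLoop, rectangleHolonomy_circleTwist ι hι, map_mul, hρι, trace_re_smul_one_mul]
  rfl

/-- `‖tr U‖ ≤ N` for a unitary `N × N` matrix. [folklore] -/
private theorem norm_trace_le_of_mem_unitaryGroup {U : Matrix (Fin N) (Fin N) ℂ}
    (hU : U ∈ Matrix.unitaryGroup (Fin N) ℂ) : ‖U.trace‖ ≤ N := by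
  calc ‖U.trace‖ = ‖∑ a, U a a‖ := rfl
    _ ≤ ∑ a, ‖U a a‖ := norm_sum_le _ _
    _ ≤ ∑ _a : Fin N, (1 : ℝ) := Finset.sum_le_sum fun a _ => entry_norm_bound_of_unitary hU a a
    _ = N := by simp

/-- The background couplings are ferromagnetic: `0 ≤ J_p(U)` for `β ≥ 0`. [cite: Grosse1988, §4.2.4 eq. (4.133)] -/
theorem bgCoupling_nonneg {β : ℝ} (hβ : 0 ≤ β) (U : GaugeConfig d L G) (p : Plaquette d L) :
    0 ≤ bgCoupling ρ β U p :=
  mul_nonneg hβ (norm_nonneg _)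

/-- The background couplings are bounded by `Nβ` for unitary `ρ` (Grosse (4.133)–(4.134): «replacing
all expressions `χ(g̃_∂P)` by» their bound). [cite: Grosse1988, §4.2.4 eq. (4.134)] -/
theorem bgCoupling_le (hρu : ∀ g, ρ g ∈ Matrix.unitaryGroup (Fin N) ℂ) {β : ℝ} (hβ : 0 ≤ β)
    (U : GaugeConfig d L G) (p : Plaquette d L) : bgCoupling ρ β U p ≤ (N : ℝ) * β := by
  rw [bgCoupling, mul_comm]
  exact mul_le_mul_of_nonneg_right (norm_trace_le_of_mem_unitaryGroup (hρu _)) hβ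

end Algebra

/-! ### The torus `U(1)` theory as a Ginibre model (any dimension) -/

section U1

variable {d L : ℕ}

/-- The `U(1)` Wilson weight is Ginibre's weight with constant couplings, up to `e^{-β|P|}`
(any dimension; cf. `exp_neg_mul_wilsonAction_u1` for `d = 4`). [cite: Ginibre1970, §2 Example 4 with Model 3 (plane rotators; `U(1)` lattice gauge theory as a generalised plane rotator)] -/
theorem exp_neg_mul_wilsonAction_u1_gen [NeZero L] (β : ℝ) (U : GaugeConfig d L Circle) :
    Real.exp (-β * wilsonAction u1Rep U) =
      Real.exp (-β * Fintype.card (Plaquette d L)) *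
        ginibreWeight (u1PlaquetteChars d L) (fun _ => β) U := by
  rw [ginibreWeight, ← Real.exp_add]
  congr 1
  have h1 : wilsonAction u1Rep U = Fintype.card (Plaquette d L) -
      ∑ q : Plaquette d L, ((plaquetteHolonomy U q.1 q.2.1.1 q.2.1.2 : Circle) : ℂ).re := by
    simp only [wilsonAction, trace_u1Rep_re, Nat.cast_one, Finset.sum_sub_distrib, Finset.sum_const,
      Finset.card_univ, nsmul_eq_mul, mul_one]
  have h2 : ginibreHamiltonian (u1PlaquetteChars d L) (fun _ => β) U =
      β * ∑ q : Plaquette d L, ((plaquetteHolonomy U q.1 q.2.1.1 q.2.1.2 : Circle) : ℂ).re := by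
    simp only [ginibreHamiltonian, reChar, u1PlaquetteChars, u1PlaqChar_apply, ← Finset.mul_sum]
  rw [h1, h2]
  ring

/-- **The torus `U(1)` Wilson loop is a Ginibre expectation** with constant couplings `β` (any
dimension `d`, side `L ≥ 1`, base point `x`; the tree's `wilsonExpectation_u1_eq_ginibreExpect` is
the case `d = 4`, `x = 0`). [cite: Ginibre1970, §2 Example 4 with Model 3 (plane rotators; `U(1)` lattice gauge theory as a generalised plane rotator)] -/
theorem wilsonExpectation_u1_eq_ginibreExpect_gen [NeZero L] (β : ℝ) (x : Site d L) (i j : Fin d)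
    (R T : ℕ) :
    wilsonExpectation (L := L) u1Rep β (wilsonLoop u1Rep x i j R T) =
      ginibreExpect (Measure.pi fun _ : Edge d L => haarProbability Circle)
        (u1PlaquetteChars d L) (fun _ => β) (reChar (u1RectChar x i j R T)) := by
  rw [wilsonExpectation_eq_div_integral u1Rep continuous_u1Rep, ginibreExpect]
  simp_rw [exp_neg_mul_wilsonAction_u1_gen, wilsonLoop_u1Rep]
  set c := Real.exp (-β * Fintype.card (Plaquette d L))
  have hc : c ≠ 0 := (Real.exp_pos _).ne'
  simp_rw [mul_left_comm _ c, integral_const_mul]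
  rw [mul_div_mul_left _ _ hc]

/-- Squaring is onto on the torus configuration group `U(1)^E` (the tree's
`exists_mul_self_eq_u1Config` in `Function.Surjective` form). [folklore] -/
private theorem surjective_mul_self_u1Config :
    Function.Surjective fun ψ : GaugeConfig d L Circle => ψ * ψ :=
  fun θ => exists_mul_self_eq_u1Config θ

/-- **Griffiths' first inequality for torus `U(1)` Wilson loops**: `0 ≤ ⟨W_{R×T}⟩_{U(1),β,L}` for
`β ≥ 0` (from the tree's MMP/Ginibre toolkit). [cite: Ginibre1970, Prop. 3 with §2 Example 4 and Model 3 (plane rotators: Griffiths' first inequality)] -/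
theorem wilsonExpectation_u1_wilsonLoop_nonneg [NeZero L] {β : ℝ} (hβ : 0 ≤ β) (x : Site d L)
    (i j : Fin d) (R T : ℕ) :
    0 ≤ wilsonExpectation (L := L) u1Rep β (wilsonLoop u1Rep x i j R T) := by
  rw [wilsonExpectation_u1_eq_ginibreExpect_gen]
  have h := abs_phasedGinibreExpect_rePhased_le (Measure.pi fun _ : Edge d L => haarProbability Circle)
    surjective_mul_self_u1Config (u1PlaquetteChars d L) (J := fun _ => β) (fun _ => hβ) 1 1
    (u1RectChar x i j R T)
  rw [rePhased_one, phasedGinibreExpect_one] at h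
  exact (abs_nonneg _).trans h

end U1

/-! ### Continuity -/

section Continuity

variable {d L N : ℕ} {G : Type*} [Group G] [TopologicalSpace G] [IsTopologicalGroup G]
  (ρ : G →* Matrix (Fin N) (Fin N) ℂ) (ι : Circle →* G)

/-- The circle twist is jointly continuous in `(U, ζ)` for continuous `ι`. [folklore] -/
private theorem continuous_circleTwist₂ (hιc : Continuous ι) :
    Continuous fun p : GaugeConfig d L G × GaugeConfig d L Circle => circleTwist ι p.2 p.1 :=
  continuous_pi fun e =>
    (hιc.comp ((continuous_apply e).comp continuous_snd)).mul ((continuous_apply e).comp continuous_fst)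

/-- Straight-path holonomies are continuous in the configuration. [folklore] -/
private theorem continuous_lineHolonomy_gen (k : Fin d) :
    ∀ (n : ℕ) (y : Site d L), Continuous fun U : GaugeConfig d L G => lineHolonomy U k n y
  | 0, _ => continuous_const
  | n + 1, _ => (continuous_apply _).mul (continuous_lineHolonomy_gen k n _)

/-- The rectangular Wilson loop observable `W_{R×T} = (1/N) Re tr ρ(hol)` is continuous on the
configuration space for continuous `ρ` (Seiler LNP 159 §1: a bounded cylinder function).
[cite: Grosse1988, §4.2.4 eq. (4.129)] -/
theorem continuous_wilsonLoop (hρ : Continuous ρ) (x : Site d L) (i j : Fin d) (R T : ℕ) :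
    Continuous (wilsonLoop (d := d) (L := L) ρ x i j R T) := by
  have h1 : Continuous fun U : GaugeConfig d L G => rectangleHolonomy U x i j R T := by
    unfold rectangleHolonomy
    exact (((continuous_lineHolonomy_gen i R x).mul (continuous_lineHolonomy_gen j T _)).mul
      (continuous_lineHolonomy_gen i R _).inv).mul (continuous_lineHolonomy_gen j T x).inv
  unfold wilsonLoop
  exact continuous_const.mul (Complex.continuous_re.comp (hρ.comp h1).matrix_trace)

end Continuity

/-! ### Haar invariance: averaging over circle twists -/

section Averaging

variable {d L N : ℕ} [NeZero L] {G : Type*} [Group G] [TopologicalSpace G] [IsTopologicalGroup G]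
  [CompactSpace G] [MeasurableSpace G] [BorelSpace G] (ρ : G →* Matrix (Fin N) (Fin N) ℂ)
  (ι : Circle →* G)

/-- The circle twist by `ζ` as a measurable automorphism of the configuration space (inverse: the
twist by `ζ⁻¹`). [cite: Grosse1988, §4.2.4 eq. (4.131)] -/
def circleTwistEquiv (ζ : GaugeConfig d L Circle) : GaugeConfig d L G ≃ᵐ GaugeConfig d L G where
  toFun := circleTwist ι ζ
  invFun := circleTwist ι ζ⁻¹
  left_inv := circleTwist_inv_circleTwist ι ζ
  right_inv := circleTwist_circleTwist_inv ι ζ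
  measurable_toFun := measurable_pi_lambda _ fun e => (measurable_pi_apply e).const_mul _
  measurable_invFun := measurable_pi_lambda _ fun e => (measurable_pi_apply e).const_mul _

/-- **The circle twist preserves product Haar measure** (link by link a left translation) —
the invariance `dg_b = d(γ_b g_b)` behind Grosse (4.131). [cite: Grosse1988, §4.2.4 eq. (4.131)] -/
theorem measurePreserving_circleTwist (ζ : GaugeConfig d L Circle) :
    MeasurePreserving (circleTwistEquiv (d := d) (L := L) ι ζ)
      (Measure.pi fun _ : Edge d L => haarProbability G) (Measure.pi fun _ : Edge d L => haarProbability G) :=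
  measurePreserving_pi (f := fun (e : Edge d L) (g : G) => ι (ζ e) * g)
    (fun _ : Edge d L => haarProbability G) (fun _ : Edge d L => haarProbability G)
    fun e => measurePreserving_mul_left (haarProbability G) (ι (ζ e))

variable [SecondCountableTopology G]

/-- **Averaged Haar invariance** (Grosse (4.131)): for continuous `g` and continuous `ι`,
`∫ g(U) dU = ∫ dU ∫_{U(1)^E} dζ g(ι(ζ)U)` — substitute `U ↦ ι(ζ)U` for each fixed `ζ` (Haar
invariance), average over `ζ` (a probability measure) and exchange the integrals (Fubini, the
integrand being continuous on a compact space). [cite: Grosse1988, §4.2.4 eq. (4.131)] -/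
theorem integral_eq_integral_integral_circleTwist (hιc : Continuous ι) {g : GaugeConfig d L G → ℝ}
    (hg : Continuous g) :
    ∫ U, g U ∂(Measure.pi fun _ : Edge d L => haarProbability G) =
      ∫ U, (∫ ζ, g (circleTwist ι ζ U) ∂(Measure.pi fun _ : Edge d L => haarProbability Circle))
        ∂(Measure.pi fun _ : Edge d L => haarProbability G) := by
  set πG : Measure (GaugeConfig d L G) := Measure.pi fun _ : Edge d L => haarProbability G
  set πU : Measure (GaugeConfig d L Circle) := Measure.pi fun _ : Edge d L => haarProbability Circle
  set F : GaugeConfig d L G × GaugeConfig d L Circle → ℝ := fun p => g (circleTwist ι p.2 p.1) with hF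
  have hFc : Continuous F := hg.comp (continuous_circleTwist₂ ι hιc)
  have hFi : Integrable F (πG.prod πU) := integrable_of_continuous_compactSpace _ hFc
  have h1 : ∫ U, (∫ ζ, g (circleTwist ι ζ U) ∂πU) ∂πG = ∫ p, F p ∂(πG.prod πU) :=
    (integral_prod F hFi).symm
  have h2 : ∫ p, F p ∂(πG.prod πU) = ∫ ζ, (∫ U, g (circleTwist ι ζ U) ∂πG) ∂πU :=
    integral_prod_symm F hFi
  have h3 : ∀ ζ, ∫ U, g (circleTwist ι ζ U) ∂πG = ∫ U, g U ∂πG := fun ζ =>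
    (measurePreserving_circleTwist ι ζ).integral_comp' (f := circleTwistEquiv ι ζ) g
  rw [h1, h2]
  simp_rw [h3]
  rw [integral_const, smul_eq_mul, probReal_univ, one_mul]

/-- Integrability of the inner `ζ`-averages as functions of the background `U`. [folklore] -/
private theorem integrable_integral_circleTwist (hιc : Continuous ι) {g : GaugeConfig d L G → ℝ}
    (hg : Continuous g) :
    Integrable (fun U => ∫ ζ, g (circleTwist ι ζ U) ∂(Measure.pi fun _ : Edge d L => haarProbability Circle))
      (Measure.pi fun _ : Edge d L => haarProbability G) := by
  set F : GaugeConfig d L G × GaugeConfig d L Circle → ℝ := fun p => g (circleTwist ι p.2 p.1) with hF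
  have hFc : Continuous F := hg.comp (continuous_circleTwist₂ ι hιc)
  have hFi : Integrable F ((Measure.pi fun _ : Edge d L => haarProbability G).prod
      (Measure.pi fun _ : Edge d L => haarProbability Circle)) :=
    integrable_of_continuous_compactSpace _ hFc
  exact hFi.integral_prod_left

/-! ### The comparison theorem -/

/-- **`U(1)`-CENTRE DOMINATION OF WILSON LOOPS** (Fröhlich 1979; Grosse 1988 (4.134) with
`Γ = U(1)`). Let `G` be a compact second-countable group, `ρ` a continuous representation on `ℂ^N`
with unitary values, `ι : U(1) → G` a continuous homomorphism into the centre on which `ρ` is scalar,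
`ρ(ι(z)) = z · 1` (e.g. `G = U(N)`, `ρ` fundamental), `β ≥ 0`, `(ℤ/Lℤ)^d` a torus. Then
`|⟨W_{R×T}⟩_{G,ρ,β,L}| ≤ ⟨W_{R×T}⟩_{U(1), Nβ, L}`:
the Wilson loop is bounded by the same Wilson loop of the `U(1)` lattice gauge theory on the same
torus at coupling `Nβ`. Proof: averaged Haar invariance (`integral_eq_integral_integral_circleTwist`)
for numerator and partition function; in the background `U` the `ζ`-integral of the numerator is
`e^{-βN|P|} Z_{J(U),u(U)} (1/N) ⟨Re(tr ρ(U_C) ζ_C)⟩_{J(U),u(U)}` and that of the denominator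
`e^{-βN|P|} Z_{J(U),u(U)}`; the Messager–Miracle-Solé–Pfister inequality with Ginibre monotonicity
(`abs_phasedGinibreExpect_re_mul_le_of_le`, `J_p(U) ≤ Nβ`) bounds the former by
`⟨Re ζ_C⟩_{Nβ} ·` the latter, pointwise in `U`. [cite: Grosse1988, §4.2.4 eq. (4.134)] -/
theorem abs_wilsonExpectation_wilsonLoop_le_centralCircle (hρ : Continuous ρ)
    (hρu : ∀ g, ρ g ∈ Matrix.unitaryGroup (Fin N) ℂ) (hιc : Continuous ι)
    (hι : ∀ z, ι z ∈ Subgroup.center G)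
    (hρι : ∀ z, ρ (ι z) = (z : ℂ) • (1 : Matrix (Fin N) (Fin N) ℂ)) {β : ℝ} (hβ : 0 ≤ β)
    (x : Site d L) (i j : Fin d) (R T : ℕ) :
    |wilsonExpectation ρ β (wilsonLoop ρ x i j R T)| ≤
      wilsonExpectation (L := L) u1Rep ((N : ℝ) * β) (wilsonLoop u1Rep x i j R T) := by
  set πG : Measure (GaugeConfig d L G) := Measure.pi fun _ : Edge d L => haarProbability G with hπG
  set πU : Measure (GaugeConfig d L Circle) := Measure.pi fun _ : Edge d L => haarProbability Circle
    with hπU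
  set χ := u1PlaquetteChars d L with hχ
  set χ₀ := u1RectChar (d := d) (L := L) x i j R T with hχ₀
  set c : ℝ := wilsonExpectation (L := L) u1Rep ((N : ℝ) * β) (wilsonLoop u1Rep x i j R T) with hc
  have hNβ : 0 ≤ (N : ℝ) * β := by positivity
  have hcE : c = ginibreExpect πU χ (fun _ => (N : ℝ) * β) (reChar χ₀) :=
    wilsonExpectation_u1_eq_ginibreExpect_gen _ x i j R T
  have hc0 : 0 ≤ c := wilsonExpectation_u1_wilsonLoop_nonneg hNβ x i j R T
  set X : GaugeConfig d L G → ℝ := wilsonLoop ρ x i j R T with hX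
  set w : GaugeConfig d L G → ℝ := fun U => Real.exp (-β * wilsonAction ρ U) with hw
  have hZpos : 0 < ∫ U, w U ∂πG := integral_exp_neg_mul_wilsonAction_pos ρ hρ β
  rw [wilsonExpectation_eq_integral_div ρ hρ β X]
  change |(∫ U, X U * w U ∂πG) / ∫ U, w U ∂πG| ≤ c
  rw [abs_div, abs_of_pos hZpos, div_le_iff₀ hZpos]
  -- continuity of the integrands
  have hXc : Continuous X := continuous_wilsonLoop ρ hρ x i j R T
  have hwc : Continuous w :=
    Real.continuous_exp.comp (continuous_const.mul (continuous_wilsonAction ρ hρ))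
  have hXwc : Continuous fun U => X U * w U := hXc.mul hwc
  -- averaged Haar invariance for the numerator and the partition function
  rw [integral_eq_integral_integral_circleTwist ι hιc hXwc, integral_eq_integral_integral_circleTwist ι hιc hwc,
    ← integral_const_mul]
  -- the background system
  set e₀ : ℝ := Real.exp (-β * ((N : ℝ) * Fintype.card (Plaquette d L))) with he₀
  set J : GaugeConfig d L G → Plaquette d L → ℝ := bgCoupling ρ β with hJ
  set u : GaugeConfig d L G → Plaquette d L → Circle := bgPhase ρ with hu
  set t : GaugeConfig d L G → ℂ := fun U => (ρ (rectangleHolonomy U x i j R T)).trace with ht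
  set Z : GaugeConfig d L G → ℝ := fun U => ∫ ζ, phasedGinibreWeight χ (J U) (u U) ζ ∂πU with hZ
  have hZU : ∀ U, 0 < Z U := fun U => integral_phasedGinibreWeight_pos πU χ (J U) (u U)
  have hw_tw : ∀ U ζ, w (circleTwist ι ζ U) = e₀ * phasedGinibreWeight χ (J U) (u U) ζ := fun U ζ =>
    exp_neg_mul_wilsonAction_circleTwist hι hρι β ζ U
  have hX_tw : ∀ U ζ, X (circleTwist ι ζ U) = (N : ℝ)⁻¹ * (t U * ((χ₀ ζ : Circle) : ℂ)).re :=
    fun U ζ => wilsonLoop_circleTwist hι hρι ζ x i j R T U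
  have hinnerB : ∀ U, ∫ ζ, w (circleTwist ι ζ U) ∂πU = e₀ * Z U := fun U => by
    simp_rw [hw_tw]; exact integral_const_mul _ _
  have hinnerA : ∀ U, ∫ ζ, X (circleTwist ι ζ U) * w (circleTwist ι ζ U) ∂πU =
      ((N : ℝ)⁻¹ * e₀) *
        (phasedGinibreExpect πU χ (J U) (u U) (fun ζ => (t U * ((χ₀ ζ : Circle) : ℂ)).re) * Z U) := by
    intro U
    have e : ∀ ζ, X (circleTwist ι ζ U) * w (circleTwist ι ζ U) =
        ((N : ℝ)⁻¹ * e₀) * ((t U * ((χ₀ ζ : Circle) : ℂ)).re * phasedGinibreWeight χ (J U) (u U) ζ) :=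
      fun ζ => by rw [hX_tw, hw_tw]; ring
    simp_rw [e]
    rw [integral_const_mul, phasedGinibreExpect, div_mul_cancel₀ _ (hZU U).ne']
  -- the pointwise bound (MMP + Ginibre)
  have hpt : ∀ U, |∫ ζ, X (circleTwist ι ζ U) * w (circleTwist ι ζ U) ∂πU| ≤
      c * ∫ ζ, w (circleTwist ι ζ U) ∂πU := by
    intro U
    rw [hinnerA, hinnerB]
    have hE := abs_phasedGinibreExpect_re_mul_le_of_le πU surjective_mul_self_u1Config χ
      (J := J U) (J' := fun _ => (N : ℝ) * β) (fun p => bgCoupling_nonneg hβ U p)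
      (fun p => bgCoupling_le hρu hβ U p) (u U) (t U) χ₀
    rw [← hcE] at hE
    have htN : ‖t U‖ ≤ N := norm_trace_le_of_mem_unitaryGroup (hρu _)
    have hNN : (N : ℝ)⁻¹ * N ≤ 1 := by
      rcases Nat.eq_zero_or_pos N with h | h
      · simp [h]
      · rw [inv_mul_cancel₀ (by positivity)]
    have he₀ : 0 < e₀ := Real.exp_pos _
    have hZ0 := hZU U
    rw [abs_mul, abs_mul, abs_mul, abs_of_pos he₀, abs_of_nonneg (by positivity : (0 : ℝ) ≤ (N : ℝ)⁻¹),
      abs_of_pos hZ0]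
    calc (N : ℝ)⁻¹ * e₀ * (|phasedGinibreExpect πU χ (J U) (u U)
            (fun ζ => (t U * ((χ₀ ζ : Circle) : ℂ)).re)| * Z U)
        ≤ (N : ℝ)⁻¹ * e₀ * ((‖t U‖ * c) * Z U) := by gcongr
      _ ≤ (N : ℝ)⁻¹ * e₀ * (((N : ℝ) * c) * Z U) := by gcongr
      _ = ((N : ℝ)⁻¹ * N) * (c * (e₀ * Z U)) := by ring
      _ ≤ 1 * (c * (e₀ * Z U)) := by gcongr
      _ = c * (e₀ * Z U) := one_mul _
  -- integrate the pointwise bound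
  have hintB := (integrable_integral_circleTwist ι hιc hwc).const_mul c
  refine (abs_integral_le_integral_abs).trans
    (integral_mono_of_nonneg (ae_of_all _ fun U => abs_nonneg _) hintB (ae_of_all _ fun U => hpt U))

/-- **Confinement is inherited from the centre `U(1)`** (Fröhlich 1979, title claim; Grosse 1988
after (4.134)): a volume-uniform area law of the `U(1)` lattice gauge theory at coupling `Nβ`
(the tree's `HasAreaLaw`) implies the area law of the `G` theory at `β`. HONEST LABEL: in `d = 4`
the `U(1)` theory deconfines at weak coupling (`Literature/Barriers/QuantumFields/AbelianDeconfinementD4`).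
[cite: Grosse1988, §4.2.4 (text after eq. (4.134))] -/
theorem hasAreaLaw_of_centralCircle (hρ : Continuous ρ) (hρu : ∀ g, ρ g ∈ Matrix.unitaryGroup (Fin N) ℂ)
    (hιc : Continuous ι) (hι : ∀ z, ι z ∈ Subgroup.center G)
    (hρι : ∀ z, ρ (ι z) = (z : ℂ) • (1 : Matrix (Fin N) (Fin N) ℂ)) {β : ℝ} (hβ : 0 ≤ β)
    (hU1 : HasAreaLaw d u1Rep ((N : ℝ) * β)) : HasAreaLaw d ρ β := by
  obtain ⟨C, c, hc, hA⟩ := hU1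
  refine ⟨C, c, hc, fun L _ x i j R T hij hR hT hRL hTL => ?_⟩
  exact (abs_wilsonExpectation_wilsonLoop_le_centralCircle ρ ι hρ hρu hιc hι hρι hβ x i j R T).trans
    ((le_abs_self _).trans (hA L x i j R T hij hR hT hRL hTL))

end Averaging

/-! ### The case `G = U(N)` -/

section Unitary

variable {d L N : ℕ}

/-- The scalar circle `z ↦ z·1` is central in `U(N)`. [folklore] -/
private theorem scalarUnitaryHom_mem_center (z : Circle) :
    (scalarUnitaryHom z : Matrix.unitaryGroup (Fin N) ℂ) ∈ Subgroup.center (Matrix.unitaryGroup (Fin N) ℂ) := by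
  rw [Subgroup.mem_center_iff]
  intro g
  apply Subtype.ext
  simp only [Submonoid.coe_mul, scalarUnitaryHom_apply, coe_scalarUnitary, Matrix.mul_smul,
    Matrix.mul_one, Matrix.smul_mul, Matrix.one_mul]

/-- `U(N) ⊆ M_N(ℂ)` is second countable. [folklore] -/
private theorem secondCountableTopology_unitaryGroup :
    SecondCountableTopology (Matrix.unitaryGroup (Fin N) ℂ) := by
  haveI : SecondCountableTopology (Matrix (Fin N) (Fin N) ℂ) :=
    inferInstanceAs (SecondCountableTopology (Fin N → Fin N → ℂ))
  exact TopologicalSpace.Subtype.secondCountableTopology (α := Matrix (Fin N) (Fin N) ℂ) _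

/-- **`U(N)` Wilson loops are dominated by `U(1)` Wilson loops at coupling `Nβ`** (Fröhlich 1979;
Grosse 1988 (4.134)): for the fundamental representation of `U(N)`, `β ≥ 0` and every torus,
`|⟨W_{R×T}⟩_{U(N),β,L}| ≤ ⟨W_{R×T}⟩_{U(1),Nβ,L}`. [cite: Grosse1988, §4.2.4 eq. (4.134)] -/
theorem unitaryGroup_abs_wilsonExpectation_wilsonLoop_le_u1 [NeZero L] {β : ℝ} (hβ : 0 ≤ β)
    (x : Site d L) (i j : Fin d) (R T : ℕ) :
    |wilsonExpectation (unitaryFundamentalRep (Fin N) ℂ) β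
        (wilsonLoop (unitaryFundamentalRep (Fin N) ℂ) x i j R T)| ≤
      wilsonExpectation (L := L) u1Rep ((N : ℝ) * β) (wilsonLoop u1Rep x i j R T) := by
  haveI := secondCountableTopology_unitaryGroup (N := N)
  exact abs_wilsonExpectation_wilsonLoop_le_centralCircle (unitaryFundamentalRep (Fin N) ℂ) scalarUnitaryHom
    continuous_subtype_val (fun g => g.2) continuous_scalarUnitaryHom scalarUnitaryHom_mem_center
    (fun z => rfl) hβ x i j R T

/-- **`U(N)` confines whenever the `U(1)` theory at coupling `Nβ` confines** (Fröhlich 1979;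
Chatterjee 2026 §3: «`U(n)` lattice gauge theory confines whenever the corresponding `U(1)` theory
does»), in the tree's `HasAreaLaw` currency. [cite: Grosse1988, §4.2.4 (text after eq. (4.134))] -/
theorem unitaryGroup_hasAreaLaw_of_u1 {β : ℝ} (hβ : 0 ≤ β) (hU1 : HasAreaLaw d u1Rep ((N : ℝ) * β)) :
    HasAreaLaw d (unitaryFundamentalRep (Fin N) ℂ) β := by
  haveI := secondCountableTopology_unitaryGroup (N := N)
  exact hasAreaLaw_of_centralCircle (unitaryFundamentalRep (Fin N) ℂ) scalarUnitaryHom continuous_subtype_val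
    (fun g => g.2) continuous_scalarUnitaryHom scalarUnitaryHom_mem_center (fun z => rfl) hβ hU1

end Unitary

end Literature.MathematicalPhysics.QuantumFieldTheory

end
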